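import Literature.NumberTheory.Sieve.GoldstonPintzYildirimThetaEulerNorm
import HarnessLib

/-!
# Goldston–Pintz–Yıldırım, *Primes in tuples I*, §9: `G(s₁, s₂)` on the full region `Re sᵢ > −1/4`

Trunk: NumberTheory / Sieve. `GoldstonPintzYildirimThetaEulerBound` proves convergence and joint
holomorphy of the `φ`-weighted `G = GStar` of (9.17)–(9.19) on `Ω₈ = {Re s₁, Re s₂ > −1/8}` with one
uniform majorant. GPY state (after (9.19)) that "`G` is analytic and uniformly bounded for
`σ₁, σ₂ > −c`, with any `c < 1/4`", and the two-variable Lemma 3 of the tree is set up on the region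
`Ω = G₂Region = {Re s₁, Re s₂ > −1/4}` of `GoldstonPintzYildirimTwoVarG`. This file extends the
results to `Ω`, by the exhaustion `Ω = ⋃_η Ω_η` (`G₂RegionSub η`, `0 < η ≤ 1/4`) with the majorant
`7(a+b+d+1)² p^{−(1+4η)}` on `Ω_η` (from `norm_gStarLog_le_of_norms` with `X = p^{−(1/2+2η)}`).
Everything here is PROVED (theorems only):

* `exp_gStarLog_of_re` — `exp(gStarLog) = (1 − W)(1 − p^{−1−s₁})^{−a}(1 − p^{−1−s₂})^{−b}(1 − p^{−1−s₁−s₂})^d`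
  under `‖W‖ ≤ 1/2` and `Re s₁, Re s₂, Re(s₁+s₂) > −1` only;
* `star_norms_le_of_mem_sub`, `starGFactor_eq_exp_gStarLog_of_mem`, `norm_gStarLog_le_rpow_of_mem_sub`,
  `norm_gStarTail_le_of_mem_sub`, `summable_gStarTail_of_mem`;
* `hasProd_starGFactor_of_mem`, `GStar_eq_prod_mul_exp_of_mem`, `multipliable_starGFactor_of_mem` —
  the product formula on all of `Ω`;
* `differentiableOn_gStarTail_sub`, **`differentiableOn_GStar₂_region`** — `G` is jointly holomorphic
  on `Ω` (SCV Weierstrass `M`-test on each `Ω_η`), `continuousOn_GStar₂_region`, and the slices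
  `differentiableOn_GStar_fst_of_re` / `differentiableOn_GStar_snd_of_re` on `Re s > −1/4`.

## References

* D. A. Goldston, J. Pintz, C. Y. Yıldırım, *Primes in tuples. I*, Ann. of Math. (2) 170 (2009),
  819–862 = arXiv:math/0508185, §9, after (9.19); §7 (7.10). [cite: GoldstonPintzYildirim2009]
-/

noncomputable section

open Finset Filter
open scoped Topology

namespace Literature.NumberTheory.Sieve.GPY

/-- `exp(gStarLog) = (1 − W_p)(1 − p^{−1−s₁})^{−a}(1 − p^{−1−s₂})^{−b}(1 − p^{−1−s₁−s₂})^{d}` when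
`‖W_p‖ ≤ 1/2` and `Re s₁, Re s₂, Re (s₁ + s₂) > −1` (`p ≥ 2`).
[cite: GoldstonPintzYildirim2009, Section 9 eq. 9.17] -/
theorem exp_gStarLog_of_re {a b d p : ℕ} (hp : 2 ≤ p) {s₁ s₂ : ℂ} (h₁ : -1 < s₁.re)
    (h₂ : -1 < s₂.re) (h₁₂ : -1 < s₁.re + s₂.re) (hW : ‖starW a b d p s₁ s₂‖ ≤ 1 / 2) :
    Complex.exp (gStarLog a b d p s₁ s₂) =
      (1 - starW a b d p s₁ s₂) * ((1 - (p : ℂ) ^ (-(1 + s₁)))⁻¹) ^ a *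
        ((1 - (p : ℂ) ^ (-(1 + s₂)))⁻¹) ^ b * (1 - (p : ℂ) ^ (-(1 + s₁ + s₂))) ^ d := by
  have hW' := one_sub_ne_zero_of_norm_le_half hW
  have hz₁ := one_sub_cpow_neg_ne_zero hp h₁
  have hz₂ := one_sub_cpow_neg_ne_zero hp h₂
  have hz₁₂ : 1 - (p : ℂ) ^ (-(1 + s₁ + s₂)) ≠ 0 := by
    rw [show (-(1 + s₁ + s₂) : ℂ) = -(1 + (s₁ + s₂)) by ring]
    exact one_sub_cpow_neg_ne_zero hp (by simp only [Complex.add_re]; linarith)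
  rw [gStarLog, Complex.exp_add, Complex.exp_sub, Complex.exp_sub, Complex.exp_nat_mul,
    Complex.exp_nat_mul, Complex.exp_nat_mul, Complex.exp_log hW', Complex.exp_log hz₁,
    Complex.exp_log hz₂, Complex.exp_log hz₁₂, div_eq_mul_inv, div_eq_mul_inv, inv_pow, inv_pow]

/-- `2m p^{−1/2} ≤ 1/2` for `p ≥ 16 m²` (`p ≥ 1`). [folklore] -/
theorem two_mul_mul_rpow_half_le {a b d p : ℕ} (hp : 1 ≤ p) (hT : 16 * (a + b + d) ^ 2 ≤ p) :
    2 * ((a : ℝ) + b + d) * (p : ℝ) ^ (-(1 / 2 : ℝ)) ≤ 1 / 2 := by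
  set m : ℕ := a + b + d with hm
  have hm' : ((a : ℝ) + b + d) = m := by rw [hm]; push_cast; ring
  rw [hm']
  rcases Nat.eq_zero_or_pos m with h0 | hmpos
  · rw [h0]; simp
  have hp0 : (0 : ℝ) < p := by exact_mod_cast hp
  have h2 : (p : ℝ) ^ (-(1 / 2 : ℝ)) = (Real.sqrt p)⁻¹ := by
    rw [Real.rpow_neg hp0.le, Real.sqrt_eq_rpow]
  have h3 : 4 * (m : ℝ) ≤ Real.sqrt p := by
    rw [Real.le_sqrt (by positivity) hp0.le]
    have : ((16 * m ^ 2 : ℕ) : ℝ) ≤ p := by exact_mod_cast hT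
    push_cast at this
    nlinarith
  have h4 : (Real.sqrt p)⁻¹ ≤ (4 * (m : ℝ))⁻¹ := inv_anti₀ (by positivity) h3
  calc 2 * (m : ℝ) * (p : ℝ) ^ (-(1 / 2 : ℝ)) ≤ 2 * m * (4 * (m : ℝ))⁻¹ := by
        rw [h2]; exact mul_le_mul_of_nonneg_left h4 (by positivity)
    _ = 1 / 2 := by field_simp; ring

/-- On `Ω_η` (`0 ≤ η ≤ 1/4`), for `p ≥ 16`, `p ≥ 16(a+b+d)²`, with `X = p^{−(1/2+2η)}`:
`‖p^{−1−z₁}‖, ‖p^{−1−z₂}‖, ‖p^{−1−z₁−z₂}‖ ≤ X`, `2(a+b+d)X ≤ 1/2` and `X ≤ 1/4`.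
[cite: GoldstonPintzYildirim2009, Section 9 eq. 9.17] -/
theorem star_norms_le_of_mem_sub (a b d : ℕ) {η : ℝ} (hη0 : 0 ≤ η) (hη : η ≤ 1 / 4) {z : ℂ × ℂ}
    (hz : z ∈ G₂RegionSub η) {p : ℕ} (hp16 : 16 ≤ p) (hT : 16 * (a + b + d) ^ 2 ≤ p) :
    ‖(p : ℂ) ^ (-(1 + z.1))‖ ≤ (p : ℝ) ^ (-(1 / 2 + 2 * η)) ∧
    ‖(p : ℂ) ^ (-(1 + z.2))‖ ≤ (p : ℝ) ^ (-(1 / 2 + 2 * η)) ∧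
    ‖(p : ℂ) ^ (-(1 + z.1 + z.2))‖ ≤ (p : ℝ) ^ (-(1 / 2 + 2 * η)) ∧
    2 * ((a : ℝ) + b + d) * (p : ℝ) ^ (-(1 / 2 + 2 * η)) ≤ 1 / 2 ∧
    (p : ℝ) ^ (-(1 / 2 + 2 * η)) ≤ 1 / 4 := by
  obtain ⟨h1, h2⟩ := hz
  have hp0 : 0 < p := by omega
  have hp1 : (1 : ℝ) ≤ p := by exact_mod_cast hp0
  have hXle : (p : ℝ) ^ (-(1 / 2 + 2 * η)) ≤ (p : ℝ) ^ (-(1 / 2 : ℝ)) :=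
    Real.rpow_le_rpow_of_exponent_le hp1 (by linarith)
  refine ⟨?_, ?_, ?_, ?_, ?_⟩
  · rw [norm_natCast_cpow_neg hp0]
    exact Real.rpow_le_rpow_of_exponent_le hp1 (by linarith)
  · rw [norm_natCast_cpow_neg hp0]
    exact Real.rpow_le_rpow_of_exponent_le hp1 (by linarith)
  · rw [norm_natCast_cpow_neg_add hp0]
    exact Real.rpow_le_rpow_of_exponent_le hp1 (by linarith)
  · calc 2 * ((a : ℝ) + b + d) * (p : ℝ) ^ (-(1 / 2 + 2 * η))
        ≤ 2 * ((a : ℝ) + b + d) * (p : ℝ) ^ (-(1 / 2 : ℝ)) :=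
          mul_le_mul_of_nonneg_left hXle (by positivity)
      _ ≤ 1 / 2 := two_mul_mul_rpow_half_le (by omega) hT
  · refine hXle.trans ?_
    have h16 : (16 : ℝ) ≤ p := by exact_mod_cast hp16
    calc (p : ℝ) ^ (-(1 / 2 : ℝ)) ≤ (16 : ℝ) ^ (-(1 / 2 : ℝ)) :=
          Real.rpow_le_rpow_of_nonpos (by norm_num) h16 (by norm_num)
      _ = 1 / 4 := by
          rw [show (16 : ℝ) = 4 ^ (2 : ℝ) by norm_num, ← Real.rpow_mul (by norm_num)]
          norm_num

/-- For `p > T` and `z ∈ Ω`: the factor of `G` (case exponents) is `exp(gStarLog)`.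
[cite: GoldstonPintzYildirim2009, Section 9 eq. 9.17] -/
theorem starGFactor_eq_exp_gStarLog_of_mem {h₀ : ℕ} {H₁ H₂ : Finset ℕ} {p : ℕ}
    (hp : starTailBound h₀ H₁ H₂ < p) {z : ℂ × ℂ} (hz : z ∈ G₂Region) :
    starGFactor h₀ H₁ H₂ (caseA h₀ H₁) (caseA h₀ H₂) (caseD h₀ H₁ H₂) p z.1 z.2 =
      Complex.exp (gStarLog (caseA h₀ H₁) (caseA h₀ H₂) (caseD h₀ H₁ H₂) p z.1 z.2) := by
  have hz' : z ∈ G₂RegionSub 0 := by simpa [G₂RegionSub, G₂Region] using hz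
  have hp16 := sixteen_le_of_starTailBound_lt hp
  have hp2 : 2 ≤ p := by omega
  obtain ⟨hx, hy, hxy, hmX, -⟩ := star_norms_le_of_mem_sub (caseA h₀ H₁) (caseA h₀ H₂) (caseD h₀ H₁ H₂)
    le_rfl (by norm_num) hz' hp16 (sq_le_of_starTailBound_lt hp)
  have hinj : Set.InjOn (fun h : ℕ => h % p) (↑(insert h₀ (H₁ ∪ H₂)) : Set ℕ) :=
    injOn_mod_of_lt (lt_of_starTailBound_lt hp)
  have hW : ‖starW (caseA h₀ H₁) (caseA h₀ H₂) (caseD h₀ H₁ H₂) p z.1 z.2‖ ≤ 1 / 2 := by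
    obtain ⟨hc, -⟩ := norm_inv_one_sub_inv_le hp2
    set X := (p : ℝ) ^ (-(1 / 2 + 2 * (0 : ℝ))) with hXdef
    have hin : ‖(caseA h₀ H₁ : ℂ) * (p : ℂ) ^ (-(1 + z.1)) + (caseA h₀ H₂ : ℂ) * (p : ℂ) ^ (-(1 + z.2)) -
        (caseD h₀ H₁ H₂ : ℂ) * (p : ℂ) ^ (-(1 + z.1 + z.2))‖ ≤
        caseA h₀ H₁ * X + caseA h₀ H₂ * X + caseD h₀ H₁ H₂ * X := by
      refine (norm_sub_le _ _).trans (add_le_add ((norm_add_le _ _).trans (add_le_add ?_ ?_)) ?_)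
      · rw [norm_mul, Complex.norm_natCast]; exact mul_le_mul_of_nonneg_left hx (Nat.cast_nonneg _)
      · rw [norm_mul, Complex.norm_natCast]; exact mul_le_mul_of_nonneg_left hy (Nat.cast_nonneg _)
      · rw [norm_mul, Complex.norm_natCast]; exact mul_le_mul_of_nonneg_left hxy (Nat.cast_nonneg _)
    rw [starW, norm_mul]
    calc ‖(1 - (p : ℂ)⁻¹)⁻¹‖ * _ ≤ 2 * (caseA h₀ H₁ * X + caseA h₀ H₂ * X + caseD h₀ H₁ H₂ * X) :=
          mul_le_mul hc hin (norm_nonneg _) (by norm_num)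
      _ = 2 * ((caseA h₀ H₁ : ℝ) + caseA h₀ H₂ + caseD h₀ H₁ H₂) * X := by ring
      _ ≤ 1 / 2 := hmX
  obtain ⟨h1, h2⟩ := hz
  rw [exp_gStarLog_of_re hp2 (by linarith) (by linarith) (by linarith) hW, starGFactor,
    starFactor_eq_generic hp2 hinj]

/-- **Tail bound on `Ω_η`** (`0 ≤ η ≤ 1/4`), `p > T`: `‖gStarLog_p‖ ≤ 7(a+b+d+1)² p^{−(1+4η)}`
(`norm_gStarLog_le_of_norms` with `X = p^{−(1/2+2η)}`, and `X/p ≤ X²`).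
[cite: GoldstonPintzYildirim2009, Section 9 eq. 9.17] -/
theorem norm_gStarLog_le_rpow_of_mem_sub {h₀ : ℕ} {H₁ H₂ : Finset ℕ} {η : ℝ} (hη0 : 0 ≤ η)
    (hη : η ≤ 1 / 4) {z : ℂ × ℂ} (hz : z ∈ G₂RegionSub η) {p : ℕ} (hp : starTailBound h₀ H₁ H₂ < p) :
    ‖gStarLog (caseA h₀ H₁) (caseA h₀ H₂) (caseD h₀ H₁ H₂) p z.1 z.2‖ ≤
      starTailConst h₀ H₁ H₂ * (p : ℝ) ^ (-(1 + 4 * η)) := by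
  have hp16 := sixteen_le_of_starTailBound_lt hp
  have hp2 : 2 ≤ p := by omega
  have hp0 : (0 : ℝ) < p := by exact_mod_cast (by omega : 0 < p)
  have hp1 : (1 : ℝ) ≤ p := by exact_mod_cast (by omega : 1 ≤ p)
  obtain ⟨hx, hy, hxy, hmX, hX4⟩ := star_norms_le_of_mem_sub (caseA h₀ H₁) (caseA h₀ H₂) (caseD h₀ H₁ H₂)
    hη0 hη hz hp16 (sq_le_of_starTailBound_lt hp)
  set X := (p : ℝ) ^ (-(1 / 2 + 2 * η)) with hXdef
  set m : ℝ := (caseA h₀ H₁ : ℝ) + caseA h₀ H₂ + caseD h₀ H₁ H₂ with hm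
  have hm0 : 0 ≤ m := by positivity
  have hX0 : 0 ≤ X := by positivity
  have hXX : X ^ 2 = (p : ℝ) ^ (-(1 + 4 * η)) := by
    rw [hXdef, ← Real.rpow_natCast, ← Real.rpow_mul hp0.le]; congr 1; push_cast; ring
  have hXp : 1 / (p : ℝ) * X ≤ X ^ 2 := by
    -- `X/p = p^{-(3/2+2η)} ≤ p^{-(1+4η)} = X²`
    rw [hXX, hXdef, one_div, ← Real.rpow_neg_one, ← Real.rpow_add hp0]
    exact Real.rpow_le_rpow_of_exponent_le hp1 (by linarith)
  have h := norm_gStarLog_le_of_norms (a := caseA h₀ H₁) (b := caseA h₀ H₂) (d := caseD h₀ H₁ H₂)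
    hp2 hx hy hxy (hX4.trans (by norm_num)) hmX
  rw [← hm] at h
  refine h.trans ?_
  have e3 : 2 / (p : ℝ) * (m * X) ≤ 2 * m * X ^ 2 := by
    have := mul_le_mul_of_nonneg_left hXp hm0
    calc 2 / (p : ℝ) * (m * X) = 2 * (m * (1 / (p : ℝ) * X)) := by ring
      _ ≤ 2 * (m * X ^ 2) := by linarith
      _ = 2 * m * X ^ 2 := by ring
  calc (2 * m * X) ^ 2 + m * X ^ 2 + 2 / p * (m * X) ≤ (2 * m * X) ^ 2 + m * X ^ 2 + 2 * m * X ^ 2 := by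
        linarith
    _ = (4 * m ^ 2 + 3 * m) * X ^ 2 := by ring
    _ ≤ 7 * (m + 1) ^ 2 * X ^ 2 := by
        refine mul_le_mul_of_nonneg_right ?_ (sq_nonneg X)
        nlinarith
    _ = starTailConst h₀ H₁ H₂ * (p : ℝ) ^ (-(1 + 4 * η)) := by rw [hXX, starTailConst, hm]

/-- `‖gStarTail p z‖ ≤ 7(a+b+d+1)² p^{−(1+4η)}` on `Ω_η`. [cite: GoldstonPintzYildirim2009, Section 9 eq. 9.17] -/
theorem norm_gStarTail_le_of_mem_sub {h₀ : ℕ} {H₁ H₂ : Finset ℕ} {η : ℝ} (hη0 : 0 ≤ η) (hη : η ≤ 1 / 4)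
    {z : ℂ × ℂ} (hz : z ∈ G₂RegionSub η) (p : Nat.Primes) :
    ‖gStarTail h₀ H₁ H₂ p z.1 z.2‖ ≤ starTailConst h₀ H₁ H₂ * (p : ℝ) ^ (-(1 + 4 * η)) := by
  unfold gStarTail
  split_ifs with hp
  · rw [norm_zero]; unfold starTailConst; positivity
  · exact norm_gStarLog_le_rpow_of_mem_sub hη0 hη hz (not_le.1 hp)

/-- `∑_p 7(a+b+d+1)² p^{−(1+4η)} < ∞` for `η > 0`. [folklore] -/
theorem summable_starTail_majorant_sub (h₀ : ℕ) (H₁ H₂ : Finset ℕ) {η : ℝ} (hη : 0 < η) :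
    Summable fun p : Nat.Primes => starTailConst h₀ H₁ H₂ * (p : ℝ) ^ (-(1 + 4 * η)) :=
  (Nat.Primes.summable_rpow.2 (by linarith)).mul_left _

/-- A point of `Ω` lies in some `Ω_η`, `0 < η ≤ 1/4`. [folklore] -/
theorem exists_mem_G₂RegionSub {z : ℂ × ℂ} (hz : z ∈ G₂Region) :
    ∃ η : ℝ, 0 < η ∧ η ≤ 1 / 4 ∧ z ∈ G₂RegionSub η := by
  obtain ⟨h1, h2⟩ := hz
  refine ⟨min (1 / 4) (min (z.1.re + 1 / 4) (z.2.re + 1 / 4)) / 2, ?_, ?_, ?_, ?_⟩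
  · refine div_pos (lt_min (by norm_num) (lt_min (by linarith) (by linarith))) two_pos
  · have := min_le_left (1 / 4 : ℝ) (min (z.1.re + 1 / 4) (z.2.re + 1 / 4)); linarith
  · show -1 / 4 + _ < z.1.re
    have hm1 := (min_le_right (1 / 4 : ℝ) _).trans (min_le_left (z.1.re + 1 / 4) (z.2.re + 1 / 4))
    linarith
  · show -1 / 4 + _ < z.2.re
    have hm2 := (min_le_right (1 / 4 : ℝ) _).trans (min_le_right (z.1.re + 1 / 4) (z.2.re + 1 / 4))
    linarith

/-- `∑_p gStarTail_p(z)` converges absolutely for `z ∈ Ω`. [cite: GoldstonPintzYildirim2009, Section 9 eq. 9.17] -/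
theorem summable_gStarTail_of_mem {h₀ : ℕ} {H₁ H₂ : Finset ℕ} {z : ℂ × ℂ} (hz : z ∈ G₂Region) :
    Summable fun p : Nat.Primes => gStarTail h₀ H₁ H₂ p z.1 z.2 := by
  obtain ⟨η, hη0, hη4, hz'⟩ := exists_mem_G₂RegionSub hz
  exact Summable.of_norm_bounded (summable_starTail_majorant_sub h₀ H₁ H₂ hη0)
    (fun p => norm_gStarTail_le_of_mem_sub hη0.le hη4 hz' p)

/-- **Convergence on all of `Ω`**: `∏_p starGFactor_p = (∏_{p ≤ T} starGFactor_p) · exp(∑_p gStarTail_p)`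
for `z ∈ Ω = {Re sᵢ > −1/4}`. [cite: GoldstonPintzYildirim2009, Section 9 eq. 9.17] -/
theorem hasProd_starGFactor_of_mem {h₀ : ℕ} {H₁ H₂ : Finset ℕ} {z : ℂ × ℂ} (hz : z ∈ G₂Region) :
    HasProd (fun p : Nat.Primes =>
        starGFactor h₀ H₁ H₂ (caseA h₀ H₁) (caseA h₀ H₂) (caseD h₀ H₁ H₂) p z.1 z.2)
      ((∏ p ∈ smallPrimes (starTailBound h₀ H₁ H₂),
          starGFactor h₀ H₁ H₂ (caseA h₀ H₁) (caseA h₀ H₂) (caseD h₀ H₁ H₂) p z.1 z.2) *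
        Complex.exp (∑' p : Nat.Primes, gStarTail h₀ H₁ H₂ p z.1 z.2)) := by
  set B := starTailBound h₀ H₁ H₂ with hB
  set F : Nat.Primes → ℂ := fun p =>
    starGFactor h₀ H₁ H₂ (caseA h₀ H₁) (caseA h₀ H₂) (caseD h₀ H₁ H₂) p z.1 z.2 with hF
  have hA : HasProd (fun p : Nat.Primes => if (p : ℕ) ≤ B then F p else 1)
      (∏ p ∈ smallPrimes B, F p) := by
    have h : HasProd (fun p : Nat.Primes => if (p : ℕ) ≤ B then F p else 1)
        (∏ p ∈ smallPrimes B, (if (p : ℕ) ≤ B then F p else 1)) :=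
      hasProd_prod_of_ne_finset_one (fun p hp => if_neg (mt mem_smallPrimes.2 hp))
    rwa [Finset.prod_congr rfl (fun p hp => if_pos (mem_smallPrimes.1 hp))] at h
  have hE : HasProd (fun p : Nat.Primes => Complex.exp (gStarTail h₀ H₁ H₂ p z.1 z.2))
      (Complex.exp (∑' p : Nat.Primes, gStarTail h₀ H₁ H₂ p z.1 z.2)) :=
    (summable_gStarTail_of_mem hz).hasSum.cexp
  have h := hA.mul hE
  convert h using 1
  funext p
  by_cases hp : (p : ℕ) ≤ B
  · simp [gStarTail, ← hB, hp, hF]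
  · rw [if_neg hp, one_mul, gStarTail, ← hB, if_neg hp, hF]
    exact starGFactor_eq_exp_gStarLog_of_mem (not_le.1 hp) hz

/-- `G = (∏_{p ≤ T} starGFactor_p) · exp(∑_p gStarTail_p)` on `Ω`. [cite: GoldstonPintzYildirim2009, Section 9 eq. 9.17] -/
theorem GStar_eq_prod_mul_exp_of_mem {h₀ : ℕ} {H₁ H₂ : Finset ℕ} {z : ℂ × ℂ} (hz : z ∈ G₂Region) :
    GStar h₀ H₁ H₂ (caseA h₀ H₁) (caseA h₀ H₂) (caseD h₀ H₁ H₂) z.1 z.2 =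
      (∏ p ∈ smallPrimes (starTailBound h₀ H₁ H₂),
          starGFactor h₀ H₁ H₂ (caseA h₀ H₁) (caseA h₀ H₂) (caseD h₀ H₁ H₂) p z.1 z.2) *
        Complex.exp (∑' p : Nat.Primes, gStarTail h₀ H₁ H₂ p z.1 z.2) :=
  (hasProd_starGFactor_of_mem hz).tprod_eq

/-- The Euler product of `G` converges on `Ω`. [cite: GoldstonPintzYildirim2009, Section 9 eq. 9.17] -/
theorem multipliable_starGFactor_of_mem {h₀ : ℕ} {H₁ H₂ : Finset ℕ} {z : ℂ × ℂ} (hz : z ∈ G₂Region) :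
    Multipliable fun p : Nat.Primes =>
      starGFactor h₀ H₁ H₂ (caseA h₀ H₁) (caseA h₀ H₂) (caseD h₀ H₁ H₂) p z.1 z.2 :=
  ⟨_, hasProd_starGFactor_of_mem hz⟩

/-- Each `gStarTail p` is differentiable on `Ω_η` (`0 ≤ η ≤ 1/4`).
[cite: GoldstonPintzYildirim2009, Section 9 eq. 9.17] -/
theorem differentiableOn_gStarTail_sub (h₀ : ℕ) (H₁ H₂ : Finset ℕ) {η : ℝ} (hη0 : 0 ≤ η) (hη : η ≤ 1 / 4)
    (p : Nat.Primes) :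
    DifferentiableOn ℂ (fun z : ℂ × ℂ => gStarTail h₀ H₁ H₂ p z.1 z.2) (G₂RegionSub η) := by
  intro z hz
  by_cases hp : (p : ℕ) ≤ starTailBound h₀ H₁ H₂
  · have : (fun z : ℂ × ℂ => gStarTail h₀ H₁ H₂ p z.1 z.2) = fun _ => 0 := funext fun _ => if_pos hp
    rw [this]
    exact (differentiableAt_const _).differentiableWithinAt
  · have heq : (fun z : ℂ × ℂ => gStarTail h₀ H₁ H₂ p z.1 z.2) =
        fun z => gStarLog (caseA h₀ H₁) (caseA h₀ H₂) (caseD h₀ H₁ H₂) p z.1 z.2 :=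
      funext fun _ => if_neg hp
    rw [heq]
    rw [not_le] at hp
    have hp16 := sixteen_le_of_starTailBound_lt hp
    have hp2 : 2 ≤ (p : ℕ) := by omega
    obtain ⟨hx, hy, hxy, hmX, hX4⟩ := star_norms_le_of_mem_sub (caseA h₀ H₁) (caseA h₀ H₂)
      (caseD h₀ H₁ H₂) hη0 hη hz hp16 (sq_le_of_starTailBound_lt hp)
    set X := ((p : ℕ) : ℝ) ^ (-(1 / 2 + 2 * η)) with hXdef
    have hX2 : X ≤ 1 / 2 := hX4.trans (by norm_num)
    have hW : ‖starW (caseA h₀ H₁) (caseA h₀ H₂) (caseD h₀ H₁ H₂) p z.1 z.2‖ ≤ 1 / 2 := by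
      obtain ⟨hc, -⟩ := norm_inv_one_sub_inv_le hp2
      have hin : ‖(caseA h₀ H₁ : ℂ) * ((p : ℕ) : ℂ) ^ (-(1 + z.1)) +
          (caseA h₀ H₂ : ℂ) * ((p : ℕ) : ℂ) ^ (-(1 + z.2)) -
          (caseD h₀ H₁ H₂ : ℂ) * ((p : ℕ) : ℂ) ^ (-(1 + z.1 + z.2))‖ ≤
          caseA h₀ H₁ * X + caseA h₀ H₂ * X + caseD h₀ H₁ H₂ * X := by
        refine (norm_sub_le _ _).trans (add_le_add ((norm_add_le _ _).trans (add_le_add ?_ ?_)) ?_)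
        · rw [norm_mul, Complex.norm_natCast]; exact mul_le_mul_of_nonneg_left hx (Nat.cast_nonneg _)
        · rw [norm_mul, Complex.norm_natCast]; exact mul_le_mul_of_nonneg_left hy (Nat.cast_nonneg _)
        · rw [norm_mul, Complex.norm_natCast]; exact mul_le_mul_of_nonneg_left hxy (Nat.cast_nonneg _)
      rw [starW, norm_mul]
      calc ‖(1 - ((p : ℕ) : ℂ)⁻¹)⁻¹‖ * _ ≤ 2 * (caseA h₀ H₁ * X + caseA h₀ H₂ * X + caseD h₀ H₁ H₂ * X) :=
            mul_le_mul hc hin (norm_nonneg _) (by norm_num)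
        _ = 2 * ((caseA h₀ H₁ : ℝ) + caseA h₀ H₂ + caseD h₀ H₁ H₂) * X := by ring
        _ ≤ 1 / 2 := hmX
    exact (differentiableAt_gStarLog₂ p.2.pos hW (hx.trans hX2) (hy.trans hX2)
      (hxy.trans hX2)).differentiableWithinAt

/-- **`G` is jointly holomorphic on `Ω = {Re s₁, Re s₂ > −1/4}`** (case exponents): on each `Ω_η`
a finite product of holomorphic factors times `exp` of a normally convergent series of holomorphic
maps (SCV Weierstrass `M`-test), as in `differentiableOn_G₂`.
[cite: GoldstonPintzYildirim2009, Section 9 eq. 9.17] -/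
theorem differentiableOn_GStar₂_region (h₀ : ℕ) (H₁ H₂ : Finset ℕ) :
    DifferentiableOn ℂ (fun z : ℂ × ℂ =>
      GStar h₀ H₁ H₂ (caseA h₀ H₁) (caseA h₀ H₂) (caseD h₀ H₁ H₂) z.1 z.2) G₂Region := by
  intro z hz
  obtain ⟨η, hη0, hη4, hzU⟩ := exists_mem_G₂RegionSub hz
  set U : Set (ℂ × ℂ) := G₂RegionSub η with hU
  have hUo : IsOpen U := isOpen_G₂RegionSub η
  have hsub : U ⊆ G₂Region := fun w hw => ⟨by have := hw.1; linarith, by have := hw.2; linarith⟩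
  have hdiff : DifferentiableOn ℂ (fun w : ℂ × ℂ =>
      (∏ p ∈ smallPrimes (starTailBound h₀ H₁ H₂),
          starGFactor h₀ H₁ H₂ (caseA h₀ H₁) (caseA h₀ H₂) (caseD h₀ H₁ H₂) p w.1 w.2) *
        Complex.exp (∑' p : Nat.Primes, gStarTail h₀ H₁ H₂ p w.1 w.2)) U := by
    refine DifferentiableOn.mul ?_ ?_
    · intro w hw
      classical
      have h := HasFDerivAt.finsetProd (u := smallPrimes (starTailBound h₀ H₁ H₂))
        (g := fun (p : Nat.Primes) (w : ℂ × ℂ) =>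
          starGFactor h₀ H₁ H₂ (caseA h₀ H₁) (caseA h₀ H₂) (caseD h₀ H₁ H₂) p w.1 w.2) (x := w)
        (fun p _ => (differentiableAt_starGFactor₂ h₀ H₁ H₂ _ _ _ p.2.two_le
          (by have := (hsub hw).1; linarith) (by have := (hsub hw).2; linarith)).hasFDerivAt)
      exact h.differentiableAt.differentiableWithinAt
    · exact (Literature.Analysis.Complex.SCV.analyticOnNhd_tsum_of_summable_norm hUo
        (fun p => differentiableOn_gStarTail_sub h₀ H₁ H₂ hη0.le hη4 p)
        (summable_starTail_majorant_sub h₀ H₁ H₂ hη0)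
        (fun p w hw => norm_gStarTail_le_of_mem_sub hη0.le hη4 hw p)).differentiableOn.cexp
  have hGU : DifferentiableOn ℂ (fun w : ℂ × ℂ =>
      GStar h₀ H₁ H₂ (caseA h₀ H₁) (caseA h₀ H₂) (caseD h₀ H₁ H₂) w.1 w.2) U :=
    hdiff.congr fun w hw => GStar_eq_prod_mul_exp_of_mem (hsub hw)
  exact (hGU.differentiableAt (hUo.mem_nhds hzU)).differentiableWithinAt

/-- `G` is continuous on `Ω`. [cite: GoldstonPintzYildirim2009, Section 9 eq. 9.17] -/
theorem continuousOn_GStar₂_region (h₀ : ℕ) (H₁ H₂ : Finset ℕ) :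
    ContinuousOn (fun z : ℂ × ℂ =>
      GStar h₀ H₁ H₂ (caseA h₀ H₁) (caseA h₀ H₂) (caseD h₀ H₁ H₂) z.1 z.2) G₂Region :=
  (differentiableOn_GStar₂_region h₀ H₁ H₂).continuousOn

/-- Slices: `G(·, s₂)` is holomorphic on `Re s₁ > −1/4` for `Re s₂ > −1/4`.
[cite: GoldstonPintzYildirim2009, Section 9 eq. 9.17] -/
theorem differentiableOn_GStar_fst_of_re (h₀ : ℕ) (H₁ H₂ : Finset ℕ) {s₂ : ℂ} (hs₂ : -1 / 4 < s₂.re) :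
    DifferentiableOn ℂ (fun s₁ : ℂ =>
      GStar h₀ H₁ H₂ (caseA h₀ H₁) (caseA h₀ H₂) (caseD h₀ H₁ H₂) s₁ s₂) {s₁ : ℂ | -1 / 4 < s₁.re} := by
  intro s₁ hs₁
  have h := (differentiableOn_GStar₂_region h₀ H₁ H₂).differentiableAt (x := (s₁, s₂))
    (isOpen_G₂Region.mem_nhds ⟨hs₁, hs₂⟩)
  have hi : DifferentiableAt ℂ (fun s : ℂ => (s, s₂)) s₁ :=
    differentiableAt_id.prodMk (differentiableAt_const _)
  exact (h.comp s₁ hi).differentiableWithinAt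

/-- Slices: `G(s₁, ·)` is holomorphic on `Re s₂ > −1/4` for `Re s₁ > −1/4`.
[cite: GoldstonPintzYildirim2009, Section 9 eq. 9.17] -/
theorem differentiableOn_GStar_snd_of_re (h₀ : ℕ) (H₁ H₂ : Finset ℕ) {s₁ : ℂ} (hs₁ : -1 / 4 < s₁.re) :
    DifferentiableOn ℂ (fun s₂ : ℂ =>
      GStar h₀ H₁ H₂ (caseA h₀ H₁) (caseA h₀ H₂) (caseD h₀ H₁ H₂) s₁ s₂) {s₂ : ℂ | -1 / 4 < s₂.re} := by
  intro s₂ hs₂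
  have h := (differentiableOn_GStar₂_region h₀ H₁ H₂).differentiableAt (x := (s₁, s₂))
    (isOpen_G₂Region.mem_nhds ⟨hs₁, hs₂⟩)
  have hi : DifferentiableAt ℂ (fun s : ℂ => (s₁, s)) s₂ :=
    (differentiableAt_const _).prodMk differentiableAt_id
  exact (h.comp s₂ hi).differentiableWithinAt

end Literature.NumberTheory.Sieve.GPY
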